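import Summits.AtomisticToContinuum.Crystallization.Theorems.ChartedZeroExcessLayeredLatticeLiouvilleZE

/-!
# Part ZG «BarlowBondDictionary» (lens-2 g77 rider 4; the S-side dictionary of step (L2-S), memo §6 / critic row 1383 (ii))

THE BOND GRAPH OF AN IDEAL BARLOW STACKING IN COORDINATES (configuration-free, PROVED).  For a Hägg sequence `s`, contact `1` and ideal
layer height `√(2/3)`, two sites `barlowPos 1 √(2/3) s k i j`, `barlowPos 1 √(2/3) s k′ i′ j′` are at distance EXACTLY `1` iff
EITHER they lie in the same sheet (`k′ = k`) and `(i, j) ~ (i′, j′)` are Löschian neighbours (`LoAdj`, tree …ZD), OR they lie in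
height-adjacent sheets (`k′ = k + 1`, resp. `k = k′ + 1`) and the lower site caps the upper one (`CrossAdj τ`, rider ZE) with the letter
`τ = (s k = 1)` of the step (`barlow_bond_iff`).  Through the chart `Φ` of `IsCharted` (`dist = 1 ↔ IsBond`) this IS the bond graph of a
charted door set `S`: the hypotheses «bond-preserving on a sheet» of tree `lattice_rigidity` and «cross-bond-preserving» of rider
`sheet_lift` are then read off a bond label directly.  Ingredients: `dist_barlowPos_sq` [Literature], `haggLabel_succ`, and two bounded
integer searches (`loAdj_iff`, `crossAdj_iff`).  0 sorry; standard axioms.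
-/

noncomputable section
open scoped BigOperators Classical
open Summit.AtomisticToContinuum.Crystallization.Theorems.ChartedPlanarOrderRigidityDoor (E3)
open Literature.MathematicalPhysics.StatisticalMechanics (IsHaggSeq haggLabel barlowPos barlowStacking haggLabel_succ dist_barlowPos_sq)

namespace Summit.AtomisticToContinuum.Crystallization.Theorems.ChartedZeroExcessLayeredLatticeLiouville

/-! ### ZG-1  Adjacencies in coordinates (bounded integer searches) -/

/-- `loAdj_iff_dir` (docstring added by the landing lane; see the module docstring). [formal bookkeeping] -/
theorem loAdj_iff_dir (p q : ℤ × ℤ) : LoAdj p q ↔ ∃ k : Fin 6, loDir k = q - p := by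
  constructor
  · rintro ⟨k, hk⟩
    exact ⟨k, by rw [hk, add_sub_cancel_left]⟩
  · rintro ⟨k, hk⟩
    exact ⟨k, by rw [hk, add_sub_cancel]⟩

/-- `crossAdj_iff_dir` (docstring added by the landing lane; see the module docstring). [formal bookkeeping] -/
theorem crossAdj_iff_dir (τ : Bool) (p q : ℤ × ℤ) : CrossAdj τ p q ↔ ∃ t : Fin 3, triVert τ t = p - q := by
  constructor
  · rintro ⟨t, ht⟩
    exact ⟨t, by rw [ht, add_sub_cancel_left]⟩
  · rintro ⟨t, ht⟩
    exact ⟨t, by rw [ht, add_sub_cancel]⟩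

/-- Löschian adjacency ⇔ the difference has Löschian norm `1`. -/
theorem loAdj_iff (i j i' j' : ℤ) :
    LoAdj (i, j) (i', j') ↔ (i - i') * (i - i') + (i - i') * (j - j') + (j - j') * (j - j') = 1 := by
  constructor
  · rintro ⟨k, hk⟩
    fin_cases k <;> simp [loDir, Prod.ext_iff] at hk <;> obtain ⟨h1, h2⟩ := hk <;> rw [h1, h2] <;> ring
  · intro h
    obtain ⟨x, hx⟩ : ∃ x : ℤ, x = i - i' := ⟨_, rfl⟩
    obtain ⟨y, hy⟩ : ∃ y : ℤ, y = j - j' := ⟨_, rfl⟩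
    rw [← hx, ← hy] at h
    have hbx : -1 ≤ x ∧ x ≤ 1 := by constructor <;> nlinarith [sq_nonneg (2 * y + x), sq_nonneg (2 * x + y)]
    have hby : -1 ≤ y ∧ y ≤ 1 := by constructor <;> nlinarith [sq_nonneg (2 * x + y), sq_nonneg (2 * y + x)]
    obtain ⟨hx1, hx2⟩ := hbx
    obtain ⟨hy1, hy2⟩ := hby
    rw [loAdj_iff_dir, show ((i', j') : ℤ × ℤ) - (i, j) = (-x, -y) from Prod.ext (by simp only [Prod.fst_sub]; omega)
      (by simp only [Prod.snd_sub]; omega)]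
    interval_cases x <;> interval_cases y <;> first | (exfalso; omega) | decide

/-- Cross-sheet (cap) adjacency ⇔ the difference lower − upper solves `x² + xy + y² = ±(x + y)` (sign = letter). -/
theorem crossAdj_iff (τ : Bool) (i j i' j' : ℤ) :
    CrossAdj τ (i, j) (i', j') ↔
      (i - i') * (i - i') + (i - i') * (j - j') + (j - j') * (j - j') = (if τ then (i - i') + (j - j') else -((i - i') + (j - j'))) := by
  constructor
  · rintro ⟨t, ht⟩
    cases τ <;> fin_cases t <;> simp [triVert, Prod.ext_iff] at ht <;> obtain ⟨h1, h2⟩ := ht <;> simp [h1, h2]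
  · intro h
    obtain ⟨x, hx⟩ : ∃ x : ℤ, x = i - i' := ⟨_, rfl⟩
    obtain ⟨y, hy⟩ : ∃ y : ℤ, y = j - j' := ⟨_, rfl⟩
    rw [← hx, ← hy] at h
    rw [crossAdj_iff_dir, show ((i, j) : ℤ × ℤ) - (i', j') = (x, y) from Prod.ext (by simp only [Prod.fst_sub]; omega)
      (by simp only [Prod.snd_sub]; omega)]
    cases τ
    · simp only [Bool.false_eq_true, ↓reduceIte] at h
      have hbx : -1 ≤ x ∧ x ≤ 0 := by
        constructor <;> nlinarith [sq_nonneg (x + 1), sq_nonneg (y + 1), sq_nonneg (x - y), sq_nonneg (x + y + 1)]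
      have hby : -1 ≤ y ∧ y ≤ 0 := by
        constructor <;> nlinarith [sq_nonneg (x + 1), sq_nonneg (y + 1), sq_nonneg (x - y), sq_nonneg (x + y + 1)]
      obtain ⟨hx1, hx2⟩ := hbx
      obtain ⟨hy1, hy2⟩ := hby
      interval_cases x <;> interval_cases y <;> first | (exfalso; omega) | decide
    · simp only [↓reduceIte] at h
      have hbx : 0 ≤ x ∧ x ≤ 1 := by
        constructor <;> nlinarith [sq_nonneg (x - 1), sq_nonneg (y - 1), sq_nonneg (x - y), sq_nonneg (x + y - 1)]
      have hby : 0 ≤ y ∧ y ≤ 1 := by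
        constructor <;> nlinarith [sq_nonneg (x - 1), sq_nonneg (y - 1), sq_nonneg (x - y), sq_nonneg (x + y - 1)]
      obtain ⟨hx1, hx2⟩ := hbx
      obtain ⟨hy1, hy2⟩ := hby
      interval_cases x <;> interval_cases y <;> first | (exfalso; omega) | decide

/-! ### ZG-2  ★ The bond dictionary of an ideal Barlow stacking -/

/-- ★ **BARLOW BOND DICTIONARY (PROVED).**  In `barlowStacking 1 √(2/3) s` (`s` Hägg) two sites are at distance `1` iff they are Löschian
neighbours in one sheet, or lower-caps-upper neighbours in height-adjacent sheets with the step's letter `τ = (s k = 1)`. -/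
theorem barlow_bond_iff {s : ℤ → ℤ} (hs : IsHaggSeq s) (k i j k' i' j' : ℤ) :
    dist (barlowPos 1 (Real.sqrt (2 / 3)) s k i j) (barlowPos 1 (Real.sqrt (2 / 3)) s k' i' j') = 1 ↔
      (k' = k ∧ LoAdj (i, j) (i', j')) ∨
      (k' = k + 1 ∧ CrossAdj (decide (s k = 1)) (i, j) (i', j')) ∨
      (k = k' + 1 ∧ CrossAdj (decide (s k' = 1)) (i', j') (i, j)) := by
  have h3 : Real.sqrt 3 ^ 2 = 3 := Real.sq_sqrt (by norm_num)
  have h23 : Real.sqrt (2 / 3) ^ 2 = 2 / 3 := Real.sq_sqrt (by norm_num)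
  have hsq := dist_barlowPos_sq 1 (Real.sqrt (2 / 3)) s k i j k' i' j'
  have key : dist (barlowPos 1 (Real.sqrt (2 / 3)) s k i j) (barlowPos 1 (Real.sqrt (2 / 3)) s k' i' j') = 1 ↔
      dist (barlowPos 1 (Real.sqrt (2 / 3)) s k i j) (barlowPos 1 (Real.sqrt (2 / 3)) s k' i' j') ^ 2 = 1 := by
    constructor
    · intro h; rw [h]; norm_num
    · intro h
      have h0 := dist_nonneg (x := barlowPos 1 (Real.sqrt (2 / 3)) s k i j) (y := barlowPos 1 (Real.sqrt (2 / 3)) s k' i' j')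
      nlinarith
  have e : (((k : ℝ) - k') * Real.sqrt (2 / 3)) ^ 2 = ((k : ℝ) - k') ^ 2 * (2 / 3) := by rw [mul_pow, h23]
  rw [key, hsq, e]
  rcases lt_trichotomy (k - k') 0 with hn | hn | hn
  · rcases lt_or_eq_of_le (Int.le_sub_one_of_lt hn) with hn2 | hn1
    · -- two or more sheets apart
      have hc : ((k : ℝ) - k') ≤ -2 := by
        have : (k : ℤ) - k' ≤ -2 := by omega
        exact_mod_cast this
      constructor
      · intro h
        exfalso
        nlinarith [sq_nonneg (1 * ((i : ℝ) - i' + ((j : ℝ) - j') / 2 + ((haggLabel s k : ℝ) - haggLabel s k') / 2)),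
          sq_nonneg (1 * Real.sqrt 3 / 2 * (((j : ℝ) - j') + ((haggLabel s k : ℝ) - haggLabel s k') / 3))]
      · rintro (⟨h, -⟩ | ⟨h, -⟩ | ⟨h, -⟩) <;> omega
    · -- `k' = k + 1`: lower `(k; i, j)`, upper `(k + 1; i', j')`, letter `s k`
      have hk' : k' = k + 1 := by omega
      subst hk'
      have hL : (haggLabel s (k + 1) : ℝ) = haggLabel s k + s k := by exact_mod_cast haggLabel_succ s k
      rw [hL]
      rcases hs k with h1 | h1
      · have hd : decide (s k = 1) = true := by simp [h1]
        rw [hd, h1]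
        constructor
        · intro h
          refine Or.inr (Or.inl ⟨rfl, ?_⟩)
          rw [crossAdj_iff]
          simp only [↓reduceIte]
          have : (((i - i') * (i - i') + (i - i') * (j - j') + (j - j') * (j - j') : ℤ) : ℝ) = (((i - i') + (j - j') : ℤ) : ℝ) := by
            push_cast at h ⊢
            linear_combination h - (1 / 4 * ((j : ℝ) - j' - 1 / 3) ^ 2) * h3
          exact_mod_cast this
        · rintro (⟨h, -⟩ | ⟨-, h⟩ | ⟨h, -⟩)
          · omega
          · rw [crossAdj_iff] at h
            simp only [↓reduceIte] at h
            have h' : (((i - i') * (i - i') + (i - i') * (j - j') + (j - j') * (j - j') : ℤ) : ℝ) = (((i - i') + (j - j') : ℤ) : ℝ) := by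
              exact_mod_cast h
            push_cast at h' ⊢
            linear_combination h' + (1 / 4 * ((j : ℝ) - j' - 1 / 3) ^ 2) * h3
          · omega
      · have hd : decide (s k = 1) = false := by simp [h1]
        rw [hd, h1]
        constructor
        · intro h
          refine Or.inr (Or.inl ⟨rfl, ?_⟩)
          rw [crossAdj_iff]
          simp only [Bool.false_eq_true, ↓reduceIte]
          have : (((i - i') * (i - i') + (i - i') * (j - j') + (j - j') * (j - j') : ℤ) : ℝ) = ((-((i - i') + (j - j')) : ℤ) : ℝ) := by
            push_cast at h ⊢
            linear_combination h - (1 / 4 * ((j : ℝ) - j' + 1 / 3) ^ 2) * h3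
          exact_mod_cast this
        · rintro (⟨h, -⟩ | ⟨-, h⟩ | ⟨h, -⟩)
          · omega
          · rw [crossAdj_iff] at h
            simp only [Bool.false_eq_true, ↓reduceIte] at h
            have h' : (((i - i') * (i - i') + (i - i') * (j - j') + (j - j') * (j - j') : ℤ) : ℝ) = ((-((i - i') + (j - j')) : ℤ) : ℝ) := by
              exact_mod_cast h
            push_cast at h' ⊢
            linear_combination h' + (1 / 4 * ((j : ℝ) - j' + 1 / 3) ^ 2) * h3
          · omega
  · -- same sheet
    have hk' : k' = k := by omega
    subst hk'
    constructor
    · intro h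
      refine Or.inl ⟨rfl, ?_⟩
      rw [loAdj_iff]
      have : (((i - i') * (i - i') + (i - i') * (j - j') + (j - j') * (j - j') : ℤ) : ℝ) = ((1 : ℤ) : ℝ) := by
        push_cast at h ⊢
        linear_combination h - (1 / 4 * ((j : ℝ) - j') ^ 2) * h3
      exact_mod_cast this
    · rintro (⟨-, h⟩ | ⟨h, -⟩ | ⟨h, -⟩)
      · rw [loAdj_iff] at h
        have h' : (((i - i') * (i - i') + (i - i') * (j - j') + (j - j') * (j - j') : ℤ) : ℝ) = ((1 : ℤ) : ℝ) := by exact_mod_cast h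
        push_cast at h' ⊢
        linear_combination h' + (1 / 4 * ((j : ℝ) - j') ^ 2) * h3
      · omega
      · omega
  · rcases lt_or_eq_of_le (Int.add_one_le_of_lt hn) with hn2 | hn1
    · -- two or more sheets apart
      have hc : (2 : ℝ) ≤ (k : ℝ) - k' := by
        have : (2 : ℤ) ≤ k - k' := by omega
        exact_mod_cast this
      constructor
      · intro h
        exfalso
        nlinarith [sq_nonneg (1 * ((i : ℝ) - i' + ((j : ℝ) - j') / 2 + ((haggLabel s k : ℝ) - haggLabel s k') / 2)),
          sq_nonneg (1 * Real.sqrt 3 / 2 * (((j : ℝ) - j') + ((haggLabel s k : ℝ) - haggLabel s k') / 3))]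
      · rintro (⟨h, -⟩ | ⟨h, -⟩ | ⟨h, -⟩) <;> omega
    · -- `k = k' + 1`: lower `(k'; i', j')`, upper `(k' + 1; i, j)`, letter `s k'`
      have hk : k = k' + 1 := by omega
      subst hk
      have hL : (haggLabel s (k' + 1) : ℝ) = haggLabel s k' + s k' := by exact_mod_cast haggLabel_succ s k'
      rw [hL]
      rcases hs k' with h1 | h1
      · have hd : decide (s k' = 1) = true := by simp [h1]
        rw [hd, h1]
        constructor
        · intro h
          refine Or.inr (Or.inr ⟨rfl, ?_⟩)
          rw [crossAdj_iff]
          simp only [↓reduceIte]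
          have : (((i' - i) * (i' - i) + (i' - i) * (j' - j) + (j' - j) * (j' - j) : ℤ) : ℝ) = (((i' - i) + (j' - j) : ℤ) : ℝ) := by
            push_cast at h ⊢
            linear_combination h - (1 / 4 * ((j : ℝ) - j' + 1 / 3) ^ 2) * h3
          exact_mod_cast this
        · rintro (⟨h, -⟩ | ⟨h, -⟩ | ⟨-, h⟩)
          · omega
          · omega
          · rw [crossAdj_iff] at h
            simp only [↓reduceIte] at h
            have h' : (((i' - i) * (i' - i) + (i' - i) * (j' - j) + (j' - j) * (j' - j) : ℤ) : ℝ) = (((i' - i) + (j' - j) : ℤ) : ℝ) := by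
              exact_mod_cast h
            push_cast at h' ⊢
            linear_combination h' + (1 / 4 * ((j : ℝ) - j' + 1 / 3) ^ 2) * h3
      · have hd : decide (s k' = 1) = false := by simp [h1]
        rw [hd, h1]
        constructor
        · intro h
          refine Or.inr (Or.inr ⟨rfl, ?_⟩)
          rw [crossAdj_iff]
          simp only [Bool.false_eq_true, ↓reduceIte]
          have : (((i' - i) * (i' - i) + (i' - i) * (j' - j) + (j' - j) * (j' - j) : ℤ) : ℝ) = ((-((i' - i) + (j' - j)) : ℤ) : ℝ) := by
            push_cast at h ⊢
            linear_combination h - (1 / 4 * ((j : ℝ) - j' - 1 / 3) ^ 2) * h3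
          exact_mod_cast this
        · rintro (⟨h, -⟩ | ⟨h, -⟩ | ⟨-, h⟩)
          · omega
          · omega
          · rw [crossAdj_iff] at h
            simp only [Bool.false_eq_true, ↓reduceIte] at h
            have h' : (((i' - i) * (i' - i) + (i' - i) * (j' - j) + (j' - j) * (j' - j) : ℤ) : ℝ) = ((-((i' - i) + (j' - j)) : ℤ) : ℝ) := by
              exact_mod_cast h
            push_cast at h' ⊢
            linear_combination h' + (1 / 4 * ((j : ℝ) - j' - 1 / 3) ^ 2) * h3

/-- ★ **THE BOND GRAPH OF A CHARTED SET, IN COORDINATES.**  For a chart `Φ` as in `IsCharted` (`dist p q = 1 ↔ IsBond (Φ p) (Φ q)` on the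
ideal stacking — `IsCharted (μS S)` hands exactly this, with `IsBond` unfolded), the bonds of `S = Φ '' barlowStacking 1 √(2/3) s` are read off
`barlow_bond_iff`: in-sheet Löschian adjacency, cross-sheet cap adjacency with the step's letter.  This is the S-side dictionary (L2-S). -/
theorem charted_bond_iff {s : ℤ → ℤ} (hs : IsHaggSeq s) {Φ : E3 → E3}
    (hΦ : ∀ p ∈ barlowStacking 1 (Real.sqrt (2 / 3)) s, ∀ q ∈ barlowStacking 1 (Real.sqrt (2 / 3)) s,
      (dist p q = 1 ↔ IsBond (Φ p) (Φ q)))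
    (k i j k' i' j' : ℤ) :
    IsBond (Φ (barlowPos 1 (Real.sqrt (2 / 3)) s k i j)) (Φ (barlowPos 1 (Real.sqrt (2 / 3)) s k' i' j')) ↔
      (k' = k ∧ LoAdj (i, j) (i', j')) ∨
      (k' = k + 1 ∧ CrossAdj (decide (s k = 1)) (i, j) (i', j')) ∨
      (k = k' + 1 ∧ CrossAdj (decide (s k' = 1)) (i', j') (i, j)) := by
  rw [← hΦ _ ⟨k, i, j, rfl⟩ _ ⟨k', i', j', rfl⟩, barlow_bond_iff hs]

end Summit.AtomisticToContinuum.Crystallization.Theorems.ChartedZeroExcessLayeredLatticeLiouville
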